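import Literature.Dynamics.SymbolicDynamics.DistortionGlue
import Literature.Dynamics.SymbolicDynamics.DistortionGlueLevel
import HarnessLib

/-!
# Gluing in the distortion subshift: the two concrete cases

The gluing construction for `d_A(Y)` (Gangloff–Sablik Prop. 32), assembled from the skeleton
surgery (`DistortionGlueGap.lean`: second block far above; `DistortionGlueLevel.lean`: second
block level and far to the right) and the symbol layer (`DistortionGlue.lean`,
`glue_of_skeleton`): for two admissible configurations `z₁, z₂`, a block size `n ≥ 2`, a range
`K` and an offset `u` in the respective region, there is an integer `V₀` such that for every
`k ≤ K`, ANY `y ∈ Y` carrying the pseudo-projection block of `z₁` around the base coordinates and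
that of `z₂` at offset `(u.1, V₀ ∓ k)` yields a configuration of `d_A(Y)` gluing the `n`-blocks
of `z₁` and `z₂` at offset `u` (`core_gap`, `core_level`). The freedom in `k` is what makes the
vertical offset in `Y` adjustable although `u` is fixed — the heart of the proof that `d_A`
turns gluing along nets into gluing along columns, and gluing along rows into block gluing.

## References

* S. Gangloff, M. Sablik, *Quantified block gluing for multidimensional subshifts of finite type:
  aperiodicity and entropy*, J. Anal. Math. 144 (2021), §5.4.2, Prop. 32 (arXiv:1706.01627).
-/

namespace Literature.Dynamics.SymbolicDynamics.Distortion

open _root_.SymbolicDynamics.FullShift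
open Literature.Dynamics.SymbolicDynamics (square mem_square IsShiftInvariant)

variable {A : Type*} {Y : Set (ℤ × ℤ → A)} (hY : IsShiftInvariant Y) {n : ℕ} (hn : 2 ≤ n)

include hY hn in
/-- **Gluing, second block far above** (`u.2 ≥ 33n + 7 + 2K`, any `u.1`): offsets
`(u.1, V₀ - k)`, `k ≤ K`, in `Y` realise the offset `u` in `d_A(Y)`.
[cite: GangloffSablik2021, §5.4.2 (arXiv numbering), Prop. 32] -/
theorem core_gap (K : ℕ) {z₁ z₂ : ℤ × ℤ → Option A} (hz₁ : IsDelta z₁) (hz₂ : IsDelta z₂)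
    (u : ℤ × ℤ) (hu : (33 * n + 7 + 2 * K : ℤ) ≤ u.2) :
    ∃ V₀ : ℤ, u.2 - (33 * n + 7) ≤ V₀ ∧ ∀ k : ℕ, k ≤ K → ∀ y ∈ Y,
      (∀ v : ℤ × ℤ, |v.1| ≤ n → |v.2| ≤ 2 * n → y v = proj hz₁ (coordOf hz₁ (baseCell hz₁) + v)) →
      (∀ v : ℤ × ℤ, |v.1| ≤ n → |v.2| ≤ 2 * n →
        y ((u.1, V₀ - k) + v) = proj hz₂ (coordOf hz₂ (baseCell hz₂) + v)) →
      ∃ z ∈ distortion Y, (∀ s ∈ square n, z s = z₁ s) ∧ ∀ s ∈ square n, z (u + s) = z₂ s := by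
  have hN₁ : IsDeltaSet (noneSet z₁) := isDelta_iff_isDeltaSet.mp hz₁
  have hN₂ : IsDeltaSet (noneSet z₂) := isDelta_iff_isDeltaSet.mp hz₂
  -- the box `⟦-(5n+1), 6n⟧²`
  set W : ℤ := -(5 * n + 1) with hW
  set E : ℤ := 6 * n with hE
  have hρ := baseRow_mem z₁
  have hρ' := baseRow_mem z₂
  obtain ⟨V₀, hV₀b, hV₀⟩ := gap_main (N₁ := noneSet z₁) (N₂ := noneSet z₂) (W := W) (E := E) (Bo := W) (T := E)
    (u := u) (K := K) (ρ₁ := baseRow z₁) (ρ₂ := baseRow z₂) hN₁ hN₂ (by omega) (by omega) (by omega)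
    (by omega) (by rcases hρ with h | h <;> omega) (by rcases hρ with h | h <;> omega)
    (by rcases hρ' with h | h <;> omega) (by rcases hρ' with h | h <;> omega)
    (apply_baseRow_ne_none hz₁) (apply_baseRow_ne_none hz₂)
  have hu' : (E : ℤ) - W + 2 * (E - W) + 4 + 2 * K ≤ u.2 := by omega
  refine ⟨V₀, by omega, fun k hk y hy hy₁ hy₂ => ?_⟩
  have hN : IsDeltaSet (gapSet (noneSet z₁) (noneSet z₂) W E W E u k) :=
    isDeltaSet_gapSet hN₁ hN₂ (by omega) (by omega) hu' hk
  · have hag₁ : ∀ p : ℤ × ℤ, -(5 * n + 1 : ℤ) ≤ p.1 → p.1 ≤ 6 * n → -(5 * n + 1 : ℤ) ≤ p.2 → p.2 ≤ 6 * n →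
        (p ∈ gapSet (noneSet z₁) (noneSet z₂) W E W E u k ↔ z₁ p = none) := by
      intro p h1 h2 h3 h4
      rw [← mem_noneSet (z := z₁)]
      exact mem_gapSet_box₁ (by omega) (by omega) hu' (by omega) (by omega) (by omega) (by omega)
    have hag₂ : ∀ p : ℤ × ℤ, -(5 * n + 1 : ℤ) ≤ p.1 → p.1 ≤ 6 * n → -(5 * n + 1 : ℤ) ≤ p.2 → p.2 ≤ 6 * n →
        (u + p ∈ gapSet (noneSet z₁) (noneSet z₂) W E W E u k ↔ z₂ p = none) := by
      intro p h1 h2 h3 h4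
      rw [← mem_noneSet (z := z₂), show u + p = ((u + p).1, (u + p).2) from rfl,
        mem_gapSet_box₂ (by omega) (by omega) hu' hk (by simp; omega) (by simp; omega) (by simp; omega)
          (by simp; omega)]
      simp
    have h₁ : skel (gapSet (noneSet z₁) (noneSet z₂) W E W E u k) (0, baseRow z₁) ≠ none := by
      rw [Ne, skel_eq_none_iff, hag₁ _ (by simp only; omega) (by simp only; omega)
        (by simp only; rcases hρ with h | h <;> omega) (by simp only; rcases hρ with h | h <;> omega)]
      exact apply_baseRow_ne_none hz₁
    have h₂ : skel (gapSet (noneSet z₁) (noneSet z₂) W E W E u k) (u.1, u.2 + baseRow z₂) ≠ none := by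
      rw [Ne, skel_eq_none_iff, show (u.1, u.2 + baseRow z₂) = u + (0, baseRow z₂) by ext <;> simp,
        hag₂ _ (by simp only; omega) (by simp only; omega)
        (by simp only; rcases hρ' with h | h <;> omega) (by simp only; rcases hρ' with h | h <;> omega)]
      exact apply_baseRow_ne_none hz₂
    exact glue_of_skeleton hY hn hz₁ hz₂ hN u (V₀ - k) hag₁ hag₂ h₁ h₂ (hV₀ k hk _ h₁ h₂) hy hy₁ hy₂

include hY hn in
/-- **Gluing, second block level and far to the right** (`|u.2| < 33n + 7 + 2K`,
`u.1 ≥ 220n + 46 + 10K`): offsets `(u.1, V₀ + k)`, `k ≤ K`, in `Y` realise the offset `u` in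
`d_A(Y)`. [cite: GangloffSablik2021, §5.4.2 (arXiv numbering), Prop. 32] -/
theorem core_level (K : ℕ) {z₁ z₂ : ℤ × ℤ → Option A} (hz₁ : IsDelta z₁) (hz₂ : IsDelta z₂)
    (u : ℤ × ℤ) (hu2 : -(33 * n + 7 + 2 * K : ℤ) < u.2) (hu2' : u.2 < 33 * n + 7 + 2 * K)
    (hu1 : (220 * n + 46 + 10 * K : ℤ) ≤ u.1) :
    ∃ V₀ : ℤ, ∀ k : ℕ, k ≤ K → ∀ y ∈ Y,
      (∀ v : ℤ × ℤ, |v.1| ≤ n → |v.2| ≤ 2 * n → y v = proj hz₁ (coordOf hz₁ (baseCell hz₁) + v)) →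
      (∀ v : ℤ × ℤ, |v.1| ≤ n → |v.2| ≤ 2 * n →
        y ((u.1, V₀ + k) + v) = proj hz₂ (coordOf hz₂ (baseCell hz₂) + v)) →
      ∃ z ∈ distortion Y, (∀ s ∈ square n, z s = z₁ s) ∧ ∀ s ∈ square n, z (u + s) = z₂ s := by
  have hN₁ : IsDeltaSet (noneSet z₁) := isDelta_iff_isDeltaSet.mp hz₁
  have hN₂ : IsDeltaSet (noneSet z₂) := isDelta_iff_isDeltaSet.mp hz₂
  set W : ℤ := -(5 * n + 1) with hW
  set E : ℤ := 6 * n with hE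
  -- constants
  set Kmax : ℕ := 55 * n + 11 + 3 * K with hKmax
  obtain ⟨H, hH⟩ : ∃ H : ℕ, (H : ℤ) = u.2 + (33 * n + 7 + 2 * K) + 33 * n + 7 + 2 * Kmax :=
    ⟨(u.2 + (33 * n + 7 + 2 * K) + 33 * n + 7 + 2 * Kmax).toNat, by omega⟩
  obtain ⟨K₀, hK₀⟩ : ∃ K₀ : ℕ, (K₀ : ℤ) = max 0 (22 * n + 4 - u.2) := ⟨(max 0 (22 * n + 4 - u.2)).toNat, by omega⟩
  have hK₀' : 22 * n + 4 - u.2 ≤ K₀ := by rw [hK₀]; exact le_max_right _ _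
  have hK₀'' : (K₀ : ℤ) ≤ max 0 (22 * n + 4 - u.2) := hK₀.le
  have hK₀K : K₀ + K ≤ Kmax := by
    have : (K₀ : ℤ) ≤ 22 * n + 4 + (33 * n + 7 + 2 * K) := by
      rw [hK₀]; exact max_le (by omega) (by omega)
    omega
  have hρ := baseRow_mem z₁
  have hρ' := baseRow_mem z₂
  have hu' : u.2 - H ≤ W - E - 2 * (E - W) - 4 - 2 * Kmax := by omega
  have hwin : E + 1 + H < u.1 + W := by omega
  have hH1 : E - W + (E - W) + 2 + 2 * Kmax ≤ H := by omega
  obtain ⟨V₀, hV₀⟩ := level_main (N₁ := noneSet z₁) (N₂ := noneSet z₂) (W := W) (E := E) (Bo := W)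
    (T := E) (u := u) (K := Kmax) (H := H) (ρ₁ := baseRow z₁) (ρ₂ := baseRow z₂) hN₁ hN₂ (by omega)
    (by omega) (by omega) hu' hwin hH1 (by rcases hρ with h | h <;> omega) (by rcases hρ with h | h <;> omega)
    (by rcases hρ' with h | h <;> omega) (by rcases hρ' with h | h <;> omega)
    (apply_baseRow_ne_none hz₁) (apply_baseRow_ne_none hz₂)
  refine ⟨V₀ + K₀, fun j hj y hy hy₁ hy₂ => ?_⟩
  have hk : K₀ + j ≤ Kmax := by omega
  have hk0 : E - W + (E - W) + 2 - u.2 ≤ ((K₀ + j : ℕ) : ℤ) := by push_cast; omega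
  have hN : IsDeltaSet (levSet (noneSet z₁) (noneSet z₂) W E W E u H (K₀ + j)) :=
    isDeltaSet_levSet hN₁ hN₂ (by omega) (by omega) hk hu' hwin
  have hag₁ : ∀ p : ℤ × ℤ, -(5 * n + 1 : ℤ) ≤ p.1 → p.1 ≤ 6 * n → -(5 * n + 1 : ℤ) ≤ p.2 → p.2 ≤ 6 * n →
      (p ∈ levSet (noneSet z₁) (noneSet z₂) W E W E u H (K₀ + j) ↔ z₁ p = none) := by
    intro p h1 h2 h3 h4
    rw [← mem_noneSet (z := z₁)]
    exact mem_levSet_box₁ (by omega) (by omega) hk hu' (by omega) (by omega) (by omega) (by omega)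
  have hag₂ : ∀ p : ℤ × ℤ, -(5 * n + 1 : ℤ) ≤ p.1 → p.1 ≤ 6 * n → -(5 * n + 1 : ℤ) ≤ p.2 → p.2 ≤ 6 * n →
      (u + p ∈ levSet (noneSet z₁) (noneSet z₂) W E W E u H (K₀ + j) ↔ z₂ p = none) := by
    intro p h1 h2 h3 h4
    rw [← mem_noneSet (z := z₂), show u + p = ((u + p).1, (u + p).2) from rfl,
      mem_levSet_box₂ (by omega) (by omega) hk hu' hwin (by simp; omega) (by simp; omega) (by simp; omega)
        (by simp; omega)]
    simp
  have h₁ : skel (levSet (noneSet z₁) (noneSet z₂) W E W E u H (K₀ + j)) (0, baseRow z₁) ≠ none := by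
    rw [Ne, skel_eq_none_iff, hag₁ _ (by simp only; omega) (by simp only; omega)
      (by simp only; rcases hρ with h | h <;> omega) (by simp only; rcases hρ with h | h <;> omega)]
    exact apply_baseRow_ne_none hz₁
  have h₂ : skel (levSet (noneSet z₁) (noneSet z₂) W E W E u H (K₀ + j)) (u.1, u.2 + baseRow z₂) ≠ none := by
    rw [Ne, skel_eq_none_iff, show (u.1, u.2 + baseRow z₂) = u + (0, baseRow z₂) by ext <;> simp,
      hag₂ _ (by simp only; omega) (by simp only; omega)
      (by simp only; rcases hρ' with h | h <;> omega) (by simp only; rcases hρ' with h | h <;> omega)]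
    exact apply_baseRow_ne_none hz₂
  have hrel := hV₀ (K₀ + j) hk hk0 (isDelta_skel_iff.mpr hN) h₁ h₂
  rw [show V₀ + ((K₀ + j : ℕ) : ℤ) = V₀ + K₀ + j by push_cast; ring] at hrel
  exact glue_of_skeleton hY hn hz₁ hz₂ hN u (V₀ + K₀ + j) hag₁ hag₂ h₁ h₂ hrel hy hy₁ hy₂

end Literature.Dynamics.SymbolicDynamics.Distortion
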